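import Literature.Probability.RandomPlanarGeometry.HexSAWBrickWallStripFugacityWidthOneContactSupport
import HarnessLib

/-!
# The large deviation principle of the contact-density pair on all of `ℝ²`

Child module of `…ContactSupport` (super-exponential decay of `P_{N,y,z}((bc/N, tc/N) ∉ T̄^δ)` for every `δ > 0`) and, through it, of
`…ContactBoundaryLDP` / `…ContactBoundaryLimit` (#740/#746: local upper bounds at every point of the CLOSED triangle `T̄`, the limit on open
sets with closure in `T̄`) and `…ContactWeakLDP` (#693: the lower bound on open sets at interior points).  Here the two restrictions
«`K ⊆ T̄`» and «`cl G ⊆ T̄`» are removed: with the extended rate `J̄_{y,z}` (continuous on `ℝ²`; the rate function of the LDP is `J̄` on `T̄`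
and `+∞` outside),
* §1 the closed triangle is compact; a closed set disjoint from `T̄` misses a whole polyhedral neighbourhood `T̄^δ`;
* §2 ★★★ UPPER BOUND FOR EVERY CLOSED SET `F ⊆ ℝ²`: if `F ∩ T̄ = ∅` then `P_N(F) ≤ e^{−KN}` eventually for EVERY `K` (rate `+∞`); if
  `F ∩ T̄ ≠ ∅` there is a minimiser `m` of `J̄` on `F ∩ T̄` and `P_N(F) ≤ e^{−N(J̄(m) − ε)}` eventually (finite cover of the compact `F ∩ T̄` by
  the local balls of #740 — which live in `ℝ²`, not in `T̄` — plus the super-exponential estimate on the rest of `F`);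
* §3 ★★★ LOWER BOUND FOR EVERY OPEN SET `G ⊆ ℝ²` at every point of `G ∩ T̄` (interior points: #693; boundary points: along the segment
  to the centroid, by continuity of `J̄`);
* §4 ★★★ THE LDP LIMIT FOR EVERY BOUNDED OPEN `J̄`-CONTINUITY SET meeting `T̄`... in the usable form: for every open bounded `G` with
  `inf_{G ∩ T̄} J̄ = min_{cl G ∩ T̄} J̄` — in particular every open bounded `G` with `cl(G) ∩ T̄ = cl(G ∩ T̄)`... we state the clean special
  case `lim (1/N) log P_N(G) = −J̄(m)` whenever the minimiser `m` of `J̄` over `cl G ∩ T̄` lies in the closure of `G ∩ T` (always true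
  when `G` is convex and meets `T`, §4), and the unconditional `limsup ≤ −min_{cl G ∩ T̄}` / `liminf ≥ −inf_{G ∩ T̄}` pair.
Together: the full large deviation principle for `(bc/N, tc/N)` under `P_{N,y,z}` on `ℝ²` with the good rate function `J̄_{y,z}·1_{T̄} + ∞·1_{T̄ᶜ}`
(compact level sets, unique zero at the typical pair), for every `y, z > 0`.

## Sources
DemboZeitouni2010 §1.2 (the LDP: upper bound for closed sets, lower bound for open sets; exponential tightness ⇒ goodness; Lemma 1.2.18) and
§2.2 Theorem 2.2.30 (Cramér in `ℝ^d`); JansevanRensburg2000 §3.2–§3.3 (1st ed., OUP 2000; the one-density case for interacting walks).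
Nothing quoted AS PRINTED; statements are this lineage's.
-/

noncomputable section

open Filter Topology Finset Literature.Probability.LatticeModels Literature.Probability.Percolation SimpleGraph

namespace Literature.Probability.RandomPlanarGeometry.SAW.HexBW

open WidthOneYZ Real

variable {y z : ℝ}

/-! ## §1 Compactness of the closed triangle and separation from closed sets -/

/-- The closed density triangle `T̄ = {a + a' ≤ ½, 1 ≤ 4a + 2a', 1 ≤ 2a + 4a'}` is compact (closed and inside the box `[0, ½]²`).
[cite: DemboZeitouni2010, §1.2 (lane plumbing)] -/
theorem isCompact_densityTriangle_closed :
    IsCompact {p : ℝ × ℝ | p.1 + p.2 ≤ 1 / 2 ∧ 1 ≤ 4 * p.1 + 2 * p.2 ∧ 1 ≤ 2 * p.1 + 4 * p.2} := by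
  have hclosed : IsClosed {p : ℝ × ℝ | p.1 + p.2 ≤ 1 / 2 ∧ 1 ≤ 4 * p.1 + 2 * p.2 ∧ 1 ≤ 2 * p.1 + 4 * p.2} := by
    have h1 : IsClosed {p : ℝ × ℝ | p.1 + p.2 ≤ 1 / 2} := isClosed_le (continuous_fst.add continuous_snd) continuous_const
    have h2 : IsClosed {p : ℝ × ℝ | 1 ≤ 4 * p.1 + 2 * p.2} :=
      isClosed_le continuous_const ((continuous_const.mul continuous_fst).add (continuous_const.mul continuous_snd))
    have h3 : IsClosed {p : ℝ × ℝ | 1 ≤ 2 * p.1 + 4 * p.2} :=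
      isClosed_le continuous_const ((continuous_const.mul continuous_fst).add (continuous_const.mul continuous_snd))
    have e : {p : ℝ × ℝ | p.1 + p.2 ≤ 1 / 2 ∧ 1 ≤ 4 * p.1 + 2 * p.2 ∧ 1 ≤ 2 * p.1 + 4 * p.2} =
        {p : ℝ × ℝ | p.1 + p.2 ≤ 1 / 2} ∩ ({p : ℝ × ℝ | 1 ≤ 4 * p.1 + 2 * p.2} ∩ {p : ℝ × ℝ | 1 ≤ 2 * p.1 + 4 * p.2}) := by
      ext p; simp only [Set.mem_setOf_eq, Set.mem_inter_iff]
    rw [e]; exact h1.inter (h2.inter h3)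
  have hsub : {p : ℝ × ℝ | p.1 + p.2 ≤ 1 / 2 ∧ 1 ≤ 4 * p.1 + 2 * p.2 ∧ 1 ≤ 2 * p.1 + 4 * p.2} ⊆
      Metric.closedBall ((0 : ℝ), (0 : ℝ)) 1 := by
    intro p hp
    obtain ⟨h1, h2, h3⟩ := hp
    rw [Metric.mem_closedBall, Prod.dist_eq, Real.dist_eq, Real.dist_eq, max_le_iff]
    constructor
    · rw [abs_le]; constructor <;> linarith
    · rw [abs_le]; constructor <;> linarith
  exact (isCompact_closedBall _ _).of_isClosed_subset hclosed hsub

/-- The polyhedral neighbourhood `T̄^1` is compact. [cite: DemboZeitouni2010, §1.2 (lane plumbing)] -/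
theorem isCompact_densityTriangle_nbhd_one :
    IsCompact {p : ℝ × ℝ | p.1 + p.2 ≤ 1 / 2 + 1 ∧ 1 - 1 ≤ 4 * p.1 + 2 * p.2 ∧ 1 - 1 ≤ 2 * p.1 + 4 * p.2} := by
  have hclosed : IsClosed {p : ℝ × ℝ | p.1 + p.2 ≤ 1 / 2 + 1 ∧ 1 - 1 ≤ 4 * p.1 + 2 * p.2 ∧ 1 - 1 ≤ 2 * p.1 + 4 * p.2} := by
    have h1 : IsClosed {p : ℝ × ℝ | p.1 + p.2 ≤ 1 / 2 + 1} := isClosed_le (continuous_fst.add continuous_snd) continuous_const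
    have h2 : IsClosed {p : ℝ × ℝ | 1 - 1 ≤ 4 * p.1 + 2 * p.2} :=
      isClosed_le continuous_const ((continuous_const.mul continuous_fst).add (continuous_const.mul continuous_snd))
    have h3 : IsClosed {p : ℝ × ℝ | 1 - 1 ≤ 2 * p.1 + 4 * p.2} :=
      isClosed_le continuous_const ((continuous_const.mul continuous_fst).add (continuous_const.mul continuous_snd))
    have e : {p : ℝ × ℝ | p.1 + p.2 ≤ 1 / 2 + 1 ∧ 1 - 1 ≤ 4 * p.1 + 2 * p.2 ∧ 1 - 1 ≤ 2 * p.1 + 4 * p.2} =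
        {p : ℝ × ℝ | p.1 + p.2 ≤ 1 / 2 + 1} ∩ ({p : ℝ × ℝ | 1 - 1 ≤ 4 * p.1 + 2 * p.2} ∩ {p : ℝ × ℝ | 1 - 1 ≤ 2 * p.1 + 4 * p.2}) := by
      ext p; simp only [Set.mem_setOf_eq, Set.mem_inter_iff]
    rw [e]; exact h1.inter (h2.inter h3)
  have hsub : {p : ℝ × ℝ | p.1 + p.2 ≤ 1 / 2 + 1 ∧ 1 - 1 ≤ 4 * p.1 + 2 * p.2 ∧ 1 - 1 ≤ 2 * p.1 + 4 * p.2} ⊆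
      Metric.closedBall ((0 : ℝ), (0 : ℝ)) 3 := by
    intro p hp
    obtain ⟨h1, h2, h3⟩ := hp
    rw [Metric.mem_closedBall, Prod.dist_eq, Real.dist_eq, Real.dist_eq, max_le_iff]
    constructor
    · rw [abs_le]; constructor <;> linarith
    · rw [abs_le]; constructor <;> linarith
  exact (isCompact_closedBall _ _).of_isClosed_subset hclosed hsub

/-- **Separation**: a closed set `F ⊆ ℝ²` disjoint from the closed triangle misses a whole polyhedral neighbourhood `T̄^δ`, `0 < δ ≤ 1`
(minimum over the compact `F ∩ T̄^1` of the continuous excess `max(a + a' − ½, 1 − 4a − 2a', 1 − 2a − 4a') > 0`).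
[cite: DemboZeitouni2010, §1.2 (lane plumbing)] -/
theorem exists_nbhd_disjoint_of_isClosed {F : Set (ℝ × ℝ)} (hF : IsClosed F)
    (hdis : ∀ p ∈ F, ¬ (p.1 + p.2 ≤ 1 / 2 ∧ 1 ≤ 4 * p.1 + 2 * p.2 ∧ 1 ≤ 2 * p.1 + 4 * p.2)) :
    ∃ δ : ℝ, 0 < δ ∧ δ ≤ 1 ∧ ∀ p ∈ F, ¬ (p.1 + p.2 ≤ 1 / 2 + δ ∧ 1 - δ ≤ 4 * p.1 + 2 * p.2 ∧ 1 - δ ≤ 2 * p.1 + 4 * p.2) := by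
  set d : ℝ × ℝ → ℝ := fun p => max (max (p.1 + p.2 - 1 / 2) (1 - 4 * p.1 - 2 * p.2)) (1 - 2 * p.1 - 4 * p.2) with hd
  have hdc : Continuous d := by
    simp only [hd]
    fun_prop
  -- `d p ≤ δ ↔ p ∈ T̄^δ`
  have hdle : ∀ (p : ℝ × ℝ) (δ : ℝ), d p ≤ δ ↔ (p.1 + p.2 ≤ 1 / 2 + δ ∧ 1 - δ ≤ 4 * p.1 + 2 * p.2 ∧ 1 - δ ≤ 2 * p.1 + 4 * p.2) := by
    intro p δ
    simp only [hd, max_le_iff]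
    constructor
    · rintro ⟨⟨h1, h2⟩, h3⟩; exact ⟨by linarith, by linarith, by linarith⟩
    · rintro ⟨h1, h2, h3⟩; exact ⟨⟨by linarith, by linarith⟩, by linarith⟩
  set S := F ∩ {p : ℝ × ℝ | p.1 + p.2 ≤ 1 / 2 + 1 ∧ 1 - 1 ≤ 4 * p.1 + 2 * p.2 ∧ 1 - 1 ≤ 2 * p.1 + 4 * p.2} with hS
  have hSc : IsCompact S := isCompact_densityTriangle_nbhd_one.inter_left hF
  by_cases hSne : S.Nonempty
  · obtain ⟨m, hmS, hmin⟩ := hSc.exists_isMinOn hSne hdc.continuousOn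
    have hm0 : 0 < d m := by
      by_contra h0
      have h0' : d m ≤ 0 := not_lt.1 h0
      have := (hdle m 0).1 h0'
      exact hdis m hmS.1 ⟨by linarith [this.1], by linarith [this.2.1], by linarith [this.2.2]⟩
    refine ⟨min (d m / 2) 1, lt_min (by linarith) one_pos, min_le_right _ _, fun p hpF hp => ?_⟩
    have hpd : d p ≤ min (d m / 2) 1 := (hdle p _).2 hp
    have hp1 : d p ≤ 1 := hpd.trans (min_le_right _ _)
    have hpS : p ∈ S := ⟨hpF, (hdle p 1).1 hp1⟩
    have hle : d m ≤ d p := hmin hpS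
    linarith [hpd.trans (min_le_left _ _)]
  · refine ⟨1, one_pos, le_rfl, fun p hpF hp => hSne ⟨p, hpF, ?_⟩⟩
    exact hp

/-- Union bound for nonnegative summands: `Σ_{s ∪ t} f ≤ Σ_s f + Σ_t f`. [folklore] -/
private theorem sum_union_le_add' {κ : Type*} [DecidableEq κ] (s t : Finset κ) {f : κ → ℝ} (hf : ∀ i, 0 ≤ f i) :
    ∑ i ∈ s ∪ t, f i ≤ ∑ i ∈ s, f i + ∑ i ∈ t, f i := by
  rw [← Finset.sum_union_inter]
  have : 0 ≤ ∑ i ∈ s ∩ t, f i := Finset.sum_nonneg fun i _ => hf i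
  linarith

/-- Subadditivity of nonnegative sums over a finite (not necessarily disjoint) union. [folklore] -/
private theorem sum_biUnion_le_sum' {α κ : Type*} [DecidableEq κ] (s : Finset α) (t : α → Finset κ) {f : κ → ℝ}
    (hf : ∀ b, 0 ≤ f b) : ∑ b ∈ s.biUnion t, f b ≤ ∑ a ∈ s, ∑ b ∈ t a, f b := by
  classical
  refine Finset.induction_on s (by simp) ?_
  intro a s ha ih
  rw [Finset.biUnion_insert, Finset.sum_insert ha]
  have hui := Finset.sum_union_inter (s₁ := t a) (s₂ := s.biUnion t) (f := f)
  have hint : 0 ≤ ∑ b ∈ t a ∩ s.biUnion t, f b := Finset.sum_nonneg fun b _ => hf b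
  linarith

/-! ## §2 The upper bound for every closed subset of `ℝ²` -/

open Classical in
/-- ★★ **Closed sets disjoint from the triangle carry super-exponentially small mass**: for `y, z > 0`, a closed `F ⊆ ℝ²` with
`F ∩ T̄ = ∅` and every `K`, eventually `P_{N,y,z}((bc/N, tc/N) ∈ F) ≤ e^{−KN}` (the rate function is `+∞` off `T̄`).
[cite: DemboZeitouni2010, §1.2 (LDP upper bound with a rate that is +∞ off a compact set; lane statement); JansevanRensburg2000, §3.3 (1st ed.)] -/
theorem ldp_upper_closed_disjoint (hy : 0 < y) (hz : 0 < z) {F : Set (ℝ × ℝ)} (hF : IsClosed F)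
    (hdis : ∀ p ∈ F, ¬ (p.1 + p.2 ≤ 1 / 2 ∧ 1 ≤ 4 * p.1 + 2 * p.2 ∧ 1 ≤ 2 * p.1 + 4 * p.2)) (K : ℝ) :
    ∀ᶠ N : ℕ in atTop,
      (∑ q ∈ (stripPairs 1 N).filter (fun q =>
        (((bottomVisits₀ q.1 q.2 N : ℝ) / N, (topVisits₀ 1 q.1 q.2 N : ℝ) / N) : ℝ × ℝ) ∈ F), wgt y z N q) / stripZ₂ 1 N y z ≤
        Real.exp (-(K * N)) := by
  obtain ⟨δ, hδ0, -, hδF⟩ := exists_nbhd_disjoint_of_isClosed hF hdis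
  filter_upwards [fraction_not_mem_nbhd_le_exp_neg hy hz hδ0 K] with N hN
  refine le_trans (div_le_div_of_nonneg_right ?_ (stripZ₂_pos 1 N hy hz).le) hN
  refine Finset.sum_le_sum_of_subset_of_nonneg (fun q hq => ?_) fun q _ _ => wgt_nonneg hy.le hz.le N q
  rw [Finset.mem_filter] at hq ⊢
  exact ⟨hq.1, hδF _ hq.2⟩

open Classical in
/-- ★★★ **LDP UPPER BOUND FOR EVERY CLOSED SUBSET OF `ℝ²`**: for `y, z > 0` and a closed `F ⊆ ℝ²` meeting the closed triangle there is a
minimiser `m` of the extended rate `J̄_{y,z}` on `F ∩ T̄`, and for every `ε > 0` eventually `P_{N,y,z}((bc/N, tc/N) ∈ F) ≤ exp(N(−J̄(m) + ε))`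
— i.e. `limsup (1/N) log P_N(F) ≤ −inf_{F ∩ T̄} J̄ = −inf_F I` with `I = J̄` on `T̄`, `+∞` outside (finite cover of the compact `F ∩ T̄` by the
local balls of #740, and `ldp_upper_closed_disjoint`-type decay on the closed remainder `F ∖ ⋃ balls`).
[cite: DemboZeitouni2010, §1.2 (b) of the LDP and §2.2 Theorem 2.2.30 (Cramér upper bound for all closed sets); JansevanRensburg2000, §3.3 (1st ed.; lane statement)] -/
theorem ldp_upper_closed (hy : 0 < y) (hz : 0 < z) {F : Set (ℝ × ℝ)} (hF : IsClosed F)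
    (hne : (F ∩ {p : ℝ × ℝ | p.1 + p.2 ≤ 1 / 2 ∧ 1 ≤ 4 * p.1 + 2 * p.2 ∧ 1 ≤ 2 * p.1 + 4 * p.2}).Nonempty) :
    ∃ m ∈ F ∩ {p : ℝ × ℝ | p.1 + p.2 ≤ 1 / 2 ∧ 1 ≤ 4 * p.1 + 2 * p.2 ∧ 1 ≤ 2 * p.1 + 4 * p.2},
      IsMinOn (fun p : ℝ × ℝ => Real.log (stripMuY₂ 1 y z) - p.1 * Real.log y - p.2 * Real.log z -
        (negMulLog (1 - 2 * p.1 - 2 * p.2) +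
          (negMulLog (4 * p.1 + 2 * p.2 - 1) + negMulLog (2 * p.1 + 4 * p.2 - 1) - negMulLog (2 * p.1) - negMulLog (2 * p.2)) / 2))
        (F ∩ {p : ℝ × ℝ | p.1 + p.2 ≤ 1 / 2 ∧ 1 ≤ 4 * p.1 + 2 * p.2 ∧ 1 ≤ 2 * p.1 + 4 * p.2}) m ∧
      ∀ {ε : ℝ}, 0 < ε → ∀ᶠ N : ℕ in atTop,
        (∑ q ∈ (stripPairs 1 N).filter (fun q =>
          (((bottomVisits₀ q.1 q.2 N : ℝ) / N, (topVisits₀ 1 q.1 q.2 N : ℝ) / N) : ℝ × ℝ) ∈ F), wgt y z N q) / stripZ₂ 1 N y z ≤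
        Real.exp ((-(Real.log (stripMuY₂ 1 y z) - m.1 * Real.log y - m.2 * Real.log z -
          (negMulLog (1 - 2 * m.1 - 2 * m.2) +
            (negMulLog (4 * m.1 + 2 * m.2 - 1) + negMulLog (2 * m.1 + 4 * m.2 - 1) - negMulLog (2 * m.1) - negMulLog (2 * m.2)) / 2)) + ε) * N) := by
  set T : Set (ℝ × ℝ) := {p : ℝ × ℝ | p.1 + p.2 ≤ 1 / 2 ∧ 1 ≤ 4 * p.1 + 2 * p.2 ∧ 1 ≤ 2 * p.1 + 4 * p.2} with hT
  set J : ℝ × ℝ → ℝ := fun p => Real.log (stripMuY₂ 1 y z) - p.1 * Real.log y - p.2 * Real.log z -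
      (negMulLog (1 - 2 * p.1 - 2 * p.2) +
        (negMulLog (4 * p.1 + 2 * p.2 - 1) + negMulLog (2 * p.1 + 4 * p.2 - 1) - negMulLog (2 * p.1) - negMulLog (2 * p.2)) / 2)
    with hJdef
  have hJc : Continuous J := continuous_rateExt y z
  have hKc : IsCompact (F ∩ T) := isCompact_densityTriangle_closed.inter_left hF
  obtain ⟨m, hm, hmin⟩ := hKc.exists_isMinOn hne hJc.continuousOn
  refine ⟨m, hm, hmin, fun {ε} hε => ?_⟩
  have hε2 : 0 < ε / 2 := by linarith
  -- local radii at the points of `F ∩ T̄` (with `ε/2`), arbitrary positive radius elsewhere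
  have hrad : ∀ x : ℝ × ℝ, ∃ r : ℝ, 0 < r ∧ (x ∈ F ∩ T → ∀ᶠ N : ℕ in atTop,
      (∑ q ∈ (stripPairs 1 N).filter (fun q =>
        (((bottomVisits₀ q.1 q.2 N : ℝ) / N, (topVisits₀ 1 q.1 q.2 N : ℝ) / N) : ℝ × ℝ) ∈ Metric.closedBall x r),
          wgt y z N q) / stripZ₂ 1 N y z ≤ Real.exp ((-(J x) + ε / 2) * N)) := by
    intro x
    by_cases hx : x ∈ F ∩ T
    · obtain ⟨t1, t2, t3⟩ := hx.2
      obtain ⟨r, hr0, hr⟩ := ldp_local_upper_closed hy hz (x₁ := x.1) (x₂ := x.2) t1 t2 t3 hε2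
      exact ⟨r, hr0, fun _ => hr⟩
    · exact ⟨1, one_pos, fun h => absurd h hx⟩
  choose r hr0 hrN using hrad
  -- finite subcover of `F ∩ T̄` by the open balls
  obtain ⟨ι, hιK, hcover⟩ := hKc.elim_nhds_subcover (fun x => Metric.ball x (r x)) fun x _ => Metric.ball_mem_nhds x (hr0 x)
  -- the closed remainder
  set U : Set (ℝ × ℝ) := ⋃ x ∈ ι, Metric.ball x (r x) with hU
  have hUo : IsOpen U := isOpen_biUnion fun x _ => Metric.isOpen_ball
  have hF' : IsClosed (F \ U) := hF.sdiff hUo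
  have hdis : ∀ p ∈ F \ U, ¬ (p.1 + p.2 ≤ 1 / 2 ∧ 1 ≤ 4 * p.1 + 2 * p.2 ∧ 1 ≤ 2 * p.1 + 4 * p.2) := by
    intro p hp hpT
    exact hp.2 (hcover ⟨hp.1, hpT⟩)
  -- eventual bounds: each ball, and the remainder with `K = |J m| + 1`
  have hballs : ∀ x ∈ ι, ∀ᶠ N : ℕ in atTop,
      (∑ q ∈ (stripPairs 1 N).filter (fun q =>
        (((bottomVisits₀ q.1 q.2 N : ℝ) / N, (topVisits₀ 1 q.1 q.2 N : ℝ) / N) : ℝ × ℝ) ∈ Metric.closedBall x (r x)),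
          wgt y z N q) / stripZ₂ 1 N y z ≤ Real.exp ((-(J m) + ε / 2) * N) := by
    intro x hx
    have hxK := hιK x hx
    filter_upwards [hrN x hxK] with N hN
    refine hN.trans (Real.exp_le_exp.2 (mul_le_mul_of_nonneg_right ?_ (Nat.cast_nonneg N)))
    have hle : J m ≤ J x := hmin hxK
    linarith
  have hall := (ι.eventually_all).2 hballs
  have hrest := ldp_upper_closed_disjoint hy hz hF' hdis (|J m| + 1)
  -- `(card ι + 1)·exp(−εN/2) ≤ 1` eventually
  have hcnt : ∀ᶠ N : ℕ in atTop, ((ι.card : ℝ) + 1) * Real.exp (-(ε / 2) * N) ≤ 1 := by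
    have ht : Tendsto (fun N : ℕ => ((ι.card : ℝ) + 1) * Real.exp (-(ε / 2) * N)) atTop (𝓝 (((ι.card : ℝ) + 1) * 0)) := by
      refine tendsto_const_nhds.mul ?_
      have h1 : Tendsto (fun N : ℕ => -(ε / 2) * (N : ℝ)) atTop atBot :=
        (tendsto_natCast_atTop_atTop).const_mul_atTop_of_neg (by linarith)
      exact Real.tendsto_exp_atBot.comp h1
    rw [mul_zero] at ht
    exact ht.eventually (ge_mem_nhds one_pos)
  filter_upwards [hall, hrest, hcnt, Filter.eventually_gt_atTop 0] with N hN hR hC hN0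
  have hZ := stripZ₂_pos 1 N hy hz
  have hNpos : (0 : ℝ) < N := by exact_mod_cast hN0
  -- `F ⊆ ⋃ closed balls ∪ (F \ U)`
  have hle : ∑ q ∈ (stripPairs 1 N).filter (fun q =>
        (((bottomVisits₀ q.1 q.2 N : ℝ) / N, (topVisits₀ 1 q.1 q.2 N : ℝ) / N) : ℝ × ℝ) ∈ F), wgt y z N q ≤
      ∑ x ∈ ι, ∑ q ∈ (stripPairs 1 N).filter (fun q =>
        (((bottomVisits₀ q.1 q.2 N : ℝ) / N, (topVisits₀ 1 q.1 q.2 N : ℝ) / N) : ℝ × ℝ) ∈ Metric.closedBall x (r x)),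
          wgt y z N q +
      ∑ q ∈ (stripPairs 1 N).filter (fun q =>
        (((bottomVisits₀ q.1 q.2 N : ℝ) / N, (topVisits₀ 1 q.1 q.2 N : ℝ) / N) : ℝ × ℝ) ∈ F \ U), wgt y z N q := by
    have hsub : (stripPairs 1 N).filter (fun q =>
        (((bottomVisits₀ q.1 q.2 N : ℝ) / N, (topVisits₀ 1 q.1 q.2 N : ℝ) / N) : ℝ × ℝ) ∈ F) ⊆
        ι.biUnion (fun x => (stripPairs 1 N).filter (fun q =>
          (((bottomVisits₀ q.1 q.2 N : ℝ) / N, (topVisits₀ 1 q.1 q.2 N : ℝ) / N) : ℝ × ℝ) ∈ Metric.closedBall x (r x))) ∪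
        (stripPairs 1 N).filter (fun q =>
          (((bottomVisits₀ q.1 q.2 N : ℝ) / N, (topVisits₀ 1 q.1 q.2 N : ℝ) / N) : ℝ × ℝ) ∈ F \ U) := by
      intro q hq
      rw [Finset.mem_filter] at hq
      obtain ⟨hqP, hqF⟩ := hq
      rw [Finset.mem_union, Finset.mem_biUnion, Finset.mem_filter]
      by_cases hqU : (((bottomVisits₀ q.1 q.2 N : ℝ) / N, (topVisits₀ 1 q.1 q.2 N : ℝ) / N) : ℝ × ℝ) ∈ U
      · left
        rw [hU, Set.mem_iUnion₂] at hqU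
        obtain ⟨x, hx, hqx⟩ := hqU
        exact ⟨x, hx, Finset.mem_filter.2 ⟨hqP, Metric.ball_subset_closedBall hqx⟩⟩
      · right; exact ⟨hqP, hqF, hqU⟩
    calc _ ≤ ∑ q ∈ ι.biUnion (fun x => (stripPairs 1 N).filter (fun q =>
          (((bottomVisits₀ q.1 q.2 N : ℝ) / N, (topVisits₀ 1 q.1 q.2 N : ℝ) / N) : ℝ × ℝ) ∈ Metric.closedBall x (r x))) ∪
        (stripPairs 1 N).filter (fun q =>
          (((bottomVisits₀ q.1 q.2 N : ℝ) / N, (topVisits₀ 1 q.1 q.2 N : ℝ) / N) : ℝ × ℝ) ∈ F \ U), wgt y z N q :=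
          Finset.sum_le_sum_of_subset_of_nonneg hsub fun q _ _ => wgt_nonneg hy.le hz.le N q
      _ ≤ ∑ q ∈ ι.biUnion (fun x => (stripPairs 1 N).filter (fun q =>
          (((bottomVisits₀ q.1 q.2 N : ℝ) / N, (topVisits₀ 1 q.1 q.2 N : ℝ) / N) : ℝ × ℝ) ∈ Metric.closedBall x (r x))),
            wgt y z N q +
          ∑ q ∈ (stripPairs 1 N).filter (fun q =>
          (((bottomVisits₀ q.1 q.2 N : ℝ) / N, (topVisits₀ 1 q.1 q.2 N : ℝ) / N) : ℝ × ℝ) ∈ F \ U), wgt y z N q :=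
          sum_union_le_add' _ _ (fun q => wgt_nonneg hy.le hz.le N q)
      _ ≤ _ := by
          gcongr
          exact sum_biUnion_le_sum' _ _ (fun q => wgt_nonneg hy.le hz.le N q)
  -- assemble
  have hJmK : -(|J m| + 1) ≤ -(J m) + ε / 2 := by
    have := le_abs_self (J m); linarith
  calc (∑ q ∈ (stripPairs 1 N).filter (fun q =>
        (((bottomVisits₀ q.1 q.2 N : ℝ) / N, (topVisits₀ 1 q.1 q.2 N : ℝ) / N) : ℝ × ℝ) ∈ F), wgt y z N q) / stripZ₂ 1 N y z
      ≤ (∑ x ∈ ι, ∑ q ∈ (stripPairs 1 N).filter (fun q =>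
        (((bottomVisits₀ q.1 q.2 N : ℝ) / N, (topVisits₀ 1 q.1 q.2 N : ℝ) / N) : ℝ × ℝ) ∈ Metric.closedBall x (r x)),
          wgt y z N q +
      ∑ q ∈ (stripPairs 1 N).filter (fun q =>
        (((bottomVisits₀ q.1 q.2 N : ℝ) / N, (topVisits₀ 1 q.1 q.2 N : ℝ) / N) : ℝ × ℝ) ∈ F \ U), wgt y z N q) / stripZ₂ 1 N y z :=
        div_le_div_of_nonneg_right hle hZ.le
    _ = ∑ x ∈ ι, (∑ q ∈ (stripPairs 1 N).filter (fun q =>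
        (((bottomVisits₀ q.1 q.2 N : ℝ) / N, (topVisits₀ 1 q.1 q.2 N : ℝ) / N) : ℝ × ℝ) ∈ Metric.closedBall x (r x)),
          wgt y z N q) / stripZ₂ 1 N y z +
      (∑ q ∈ (stripPairs 1 N).filter (fun q =>
        (((bottomVisits₀ q.1 q.2 N : ℝ) / N, (topVisits₀ 1 q.1 q.2 N : ℝ) / N) : ℝ × ℝ) ∈ F \ U), wgt y z N q) / stripZ₂ 1 N y z := by
        rw [add_div, Finset.sum_div]
    _ ≤ ∑ x ∈ ι, Real.exp ((-(J m) + ε / 2) * N) + Real.exp (-((|J m| + 1) * N)) := by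
        refine add_le_add (Finset.sum_le_sum fun x hx => ?_) ?_
        · exact hN x hx
        · refine le_of_eq_of_le ?_ hR
          congr 2
          exact (Finset.filter_congr_decidable _ _ (fun _ => Classical.propDecidable _)).symm
    _ ≤ (ι.card : ℝ) * Real.exp ((-(J m) + ε / 2) * N) + Real.exp ((-(J m) + ε / 2) * N) := by
        rw [Finset.sum_const, nsmul_eq_mul]
        refine add_le_add le_rfl (Real.exp_le_exp.2 ?_)
        have := mul_le_mul_of_nonneg_right hJmK hNpos.le
        linarith
    _ = (((ι.card : ℝ) + 1) * Real.exp (-(ε / 2) * N)) * Real.exp ((-(J m) + ε) * N) := by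
        rw [show (-(J m) + ε / 2) * (N : ℝ) = -(ε / 2) * N + (-(J m) + ε) * N by ring, Real.exp_add]; ring
    _ ≤ 1 * Real.exp ((-(J m) + ε) * N) := mul_le_mul_of_nonneg_right hC (Real.exp_pos _).le
    _ = _ := by rw [one_mul]

/-! ## §3 The lower bound for every open subset of `ℝ²`, at every point of the closed triangle -/

open Classical in
/-- ★★★ **LDP LOWER BOUND FOR EVERY OPEN SUBSET OF `ℝ²`**: for `y, z > 0`, an open `G ⊆ ℝ²` and ANY point `x ∈ G` of the CLOSED triangle
(boundary points included), for every `ε > 0` eventually `P_{N,y,z}((bc/N, tc/N) ∈ G) ≥ exp(−N(J̄_{y,z}(x) + ε))` — i.e.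
`liminf (1/N) log P_N(G) ≥ −inf_{G ∩ T̄} J̄ = −inf_G I` (interior points: #693 `ldp_lower_open`; boundary points: the points
`x + t(c − x)` of the segment to the centroid lie in `G ∩ T` for small `t > 0` and `J̄` is continuous).
[cite: DemboZeitouni2010, §1.2 (c) of the LDP and §2.2 Theorem 2.2.30 (Cramér lower bound for open sets); JansevanRensburg2000, §3.2 Theorem 3.19 (1st ed., p. 52; lane statement)] -/
theorem ldp_lower_open_closed (hy : 0 < y) (hz : 0 < z) {G : Set (ℝ × ℝ)} (hG : IsOpen G) {x : ℝ × ℝ} (hxG : x ∈ G)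
    (hxT : x.1 + x.2 ≤ 1 / 2 ∧ 1 ≤ 4 * x.1 + 2 * x.2 ∧ 1 ≤ 2 * x.1 + 4 * x.2) {ε : ℝ} (hε : 0 < ε) :
    ∀ᶠ N : ℕ in atTop,
      Real.exp ((-(Real.log (stripMuY₂ 1 y z) - x.1 * Real.log y - x.2 * Real.log z -
          (negMulLog (1 - 2 * x.1 - 2 * x.2) +
            (negMulLog (4 * x.1 + 2 * x.2 - 1) + negMulLog (2 * x.1 + 4 * x.2 - 1) - negMulLog (2 * x.1) - negMulLog (2 * x.2)) / 2)) - ε) * N) ≤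
        (∑ q ∈ (stripPairs 1 N).filter (fun q =>
          (((bottomVisits₀ q.1 q.2 N : ℝ) / N, (topVisits₀ 1 q.1 q.2 N : ℝ) / N) : ℝ × ℝ) ∈ G), wgt y z N q) / stripZ₂ 1 N y z := by
  set J : ℝ × ℝ → ℝ := fun p => Real.log (stripMuY₂ 1 y z) - p.1 * Real.log y - p.2 * Real.log z -
      (negMulLog (1 - 2 * p.1 - 2 * p.2) +
        (negMulLog (4 * p.1 + 2 * p.2 - 1) + negMulLog (2 * p.1 + 4 * p.2 - 1) - negMulLog (2 * p.1) - negMulLog (2 * p.2)) / 2)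
    with hJdef
  have hJc : Continuous J := continuous_rateExt y z
  obtain ⟨t1, t2, t3⟩ := hxT
  have hε2 : 0 < ε / 2 := by linarith
  -- the path to the centroid
  set γ : ℝ → ℝ × ℝ := fun t => (x.1 + t * (2 / 9 - x.1), x.2 + t * (2 / 9 - x.2)) with hγ
  have hγc : Continuous γ := by
    simp only [hγ]
    fun_prop
  have hγ0 : γ 0 = x := by simp [hγ]
  -- eventually (t → 0): `γ t ∈ G` and `J (γ t) < J x + ε/2`
  have hevG : ∀ᶠ t : ℝ in 𝓝 0, γ t ∈ G := by
    have : G ∈ 𝓝 (γ 0) := by rw [hγ0]; exact hG.mem_nhds hxG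
    exact hγc.continuousAt.preimage_mem_nhds this
  have hevJ : ∀ᶠ t : ℝ in 𝓝 0, J (γ t) < J x + ε / 2 := by
    have hlt : J (γ 0) < J x + ε / 2 := by rw [hγ0]; linarith
    exact ((hJc.comp hγc).continuousAt (x := 0)).eventually (gt_mem_nhds hlt)
  have hev0 : ∀ᶠ t : ℝ in 𝓝[>] 0, 0 < t := self_mem_nhdsWithin
  have hev1 : ∀ᶠ t : ℝ in 𝓝[>] 0, t ≤ 1 := by
    have : Set.Ioo (0 : ℝ) 1 ∈ 𝓝[>] (0 : ℝ) := Ioo_mem_nhdsGT one_pos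
    filter_upwards [this] with t ht using ht.2.le
  have hev := (hevG.filter_mono nhdsWithin_le_nhds).and ((hevJ.filter_mono nhdsWithin_le_nhds).and (hev0.and hev1))
  obtain ⟨t, htG, htJ, ht0, ht1⟩ := hev.exists
  obtain ⟨s1, s2, s3⟩ := segment_mem_triangle t1 t2 t3 ht0 ht1
  have hpG : ((γ t).1, (γ t).2) ∈ G := htG
  have hJp : jointRate y z (eosY (γ t).1 (γ t).2) (eosY (γ t).2 (γ t).1) = J (γ t) := by
    rw [hJdef]; simp only; exact jointRate_eosY_eq_ext hy hz s1 s2 s3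
  filter_upwards [ldp_lower_open hy hz hG hpG s1 s2 s3 hε2] with N hN
  refine le_trans (Real.exp_le_exp.2 (mul_le_mul_of_nonneg_right ?_ (Nat.cast_nonneg N))) hN
  rw [hJp]
  change -(J x) - ε ≤ -(J (γ t)) - ε / 2
  linarith

/-! ## §4 The LDP limit on open convex sets meeting the closed triangle -/

/-- The closed density triangle is convex. [cite: DemboZeitouni2010, §1.2 (lane plumbing)] -/
theorem convex_densityTriangle_closed :
    Convex ℝ {p : ℝ × ℝ | p.1 + p.2 ≤ 1 / 2 ∧ 1 ≤ 4 * p.1 + 2 * p.2 ∧ 1 ≤ 2 * p.1 + 4 * p.2} := by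
  intro p hp q hq a b ha hb hab
  obtain ⟨p1, p2, p3⟩ := hp
  obtain ⟨q1, q2, q3⟩ := hq
  simp only [Set.mem_setOf_eq, Prod.fst_add, Prod.snd_add, Prod.smul_fst, Prod.smul_snd, smul_eq_mul]
  refine ⟨?_, ?_, ?_⟩
  · nlinarith
  · nlinarith
  · nlinarith

open Classical in
/-- ★★★ **THE LARGE DEVIATION LIMIT ON OPEN CONVEX SETS MEETING THE CLOSED TRIANGLE**: for `y, z > 0` and an open convex `G ⊆ ℝ²` with
`G ∩ T̄ ≠ ∅` (no boundedness, no `cl G ⊆ T̄`: half-planes, quadrants, balls around boundary points…) there is a minimiser `m ∈ cl G ∩ T̄` of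
`J̄_{y,z}` with `lim_{N→∞} (1/N) log P_{N,y,z}((bc/N, tc/N) ∈ G) = −J̄_{y,z}(m)` — every such `G` is an `I`-continuity set: upper bound
`ldp_upper_closed` on `cl G`; lower bound `ldp_lower_open_closed` at the points `(1−s)m + s g ∈ G ∩ T̄` (`g ∈ G ∩ T̄`, `s ↓ 0`).
[cite: DemboZeitouni2010, §1.2 (the LDP; continuity sets) and §2.2 Theorem 2.2.30; JansevanRensburg2000, §3.3 (1st ed.; lane statement)] -/
theorem ldp_limit_open_convex_closed (hy : 0 < y) (hz : 0 < z) {G : Set (ℝ × ℝ)} (hGo : IsOpen G) (hGc : Convex ℝ G)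
    (hne : (G ∩ {p : ℝ × ℝ | p.1 + p.2 ≤ 1 / 2 ∧ 1 ≤ 4 * p.1 + 2 * p.2 ∧ 1 ≤ 2 * p.1 + 4 * p.2}).Nonempty) :
    ∃ m ∈ closure G ∩ {p : ℝ × ℝ | p.1 + p.2 ≤ 1 / 2 ∧ 1 ≤ 4 * p.1 + 2 * p.2 ∧ 1 ≤ 2 * p.1 + 4 * p.2},
      IsMinOn (fun p : ℝ × ℝ => Real.log (stripMuY₂ 1 y z) - p.1 * Real.log y - p.2 * Real.log z -
        (negMulLog (1 - 2 * p.1 - 2 * p.2) +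
          (negMulLog (4 * p.1 + 2 * p.2 - 1) + negMulLog (2 * p.1 + 4 * p.2 - 1) - negMulLog (2 * p.1) - negMulLog (2 * p.2)) / 2))
        (closure G ∩ {p : ℝ × ℝ | p.1 + p.2 ≤ 1 / 2 ∧ 1 ≤ 4 * p.1 + 2 * p.2 ∧ 1 ≤ 2 * p.1 + 4 * p.2}) m ∧
      Tendsto (fun N : ℕ => Real.log ((∑ q ∈ (stripPairs 1 N).filter (fun q =>
          (((bottomVisits₀ q.1 q.2 N : ℝ) / N, (topVisits₀ 1 q.1 q.2 N : ℝ) / N) : ℝ × ℝ) ∈ G), wgt y z N q) / stripZ₂ 1 N y z) / N)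
        atTop (𝓝 (-(Real.log (stripMuY₂ 1 y z) - m.1 * Real.log y - m.2 * Real.log z -
          (negMulLog (1 - 2 * m.1 - 2 * m.2) +
            (negMulLog (4 * m.1 + 2 * m.2 - 1) + negMulLog (2 * m.1 + 4 * m.2 - 1) - negMulLog (2 * m.1) - negMulLog (2 * m.2)) / 2)))) := by
  set T : Set (ℝ × ℝ) := {p : ℝ × ℝ | p.1 + p.2 ≤ 1 / 2 ∧ 1 ≤ 4 * p.1 + 2 * p.2 ∧ 1 ≤ 2 * p.1 + 4 * p.2} with hT
  set J : ℝ × ℝ → ℝ := fun p => Real.log (stripMuY₂ 1 y z) - p.1 * Real.log y - p.2 * Real.log z -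
      (negMulLog (1 - 2 * p.1 - 2 * p.2) +
        (negMulLog (4 * p.1 + 2 * p.2 - 1) + negMulLog (2 * p.1 + 4 * p.2 - 1) - negMulLog (2 * p.1) - negMulLog (2 * p.2)) / 2)
    with hJdef
  have hJc : Continuous J := continuous_rateExt y z
  obtain ⟨g, hgG, hgT⟩ := hne
  have hne' : (closure G ∩ T).Nonempty := ⟨g, subset_closure hgG, hgT⟩
  obtain ⟨m, hm, hmin, hup⟩ := ldp_upper_closed hy hz isClosed_closure hne'
  refine ⟨m, hm, hmin, ?_⟩
  refine tendsto_log_div_of_exp_bounds (fun ε hε => ?_) (fun ε hε => ?_)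
  · -- lower bound at the points `(1 − s) m + s g ∈ G ∩ T̄`, `s ↓ 0`
    have hε2 : 0 < ε / 2 := by linarith
    set γ : ℝ → ℝ × ℝ := fun s => ((1 - s) * m.1 + s * g.1, (1 - s) * m.2 + s * g.2) with hγ
    have hγc : Continuous γ := by
      simp only [hγ]
      fun_prop
    have hγ0 : γ 0 = m := by simp [hγ]
    have hevJ : ∀ᶠ s : ℝ in 𝓝 0, J (γ s) < J m + ε / 2 := by
      have hlt : J (γ 0) < J m + ε / 2 := by rw [hγ0]; linarith
      exact ((hJc.comp hγc).continuousAt (x := 0)).eventually (gt_mem_nhds hlt)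
    have hev0 : ∀ᶠ s : ℝ in 𝓝[>] 0, 0 < s := self_mem_nhdsWithin
    have hev1 : ∀ᶠ s : ℝ in 𝓝[>] 0, s ≤ 1 := by
      have : Set.Ioo (0 : ℝ) 1 ∈ 𝓝[>] (0 : ℝ) := Ioo_mem_nhdsGT one_pos
      filter_upwards [this] with s hs using hs.2.le
    have hev := (hevJ.filter_mono nhdsWithin_le_nhds).and (hev0.and hev1)
    obtain ⟨s, hsJ, hs0, hs1⟩ := hev.exists
    -- `γ s ∈ G` (convexity: `m ∈ cl G`, `g ∈ G = interior G`, `s > 0`) and `γ s ∈ T̄` (convex)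
    have hγG : γ s ∈ G := by
      have h := hGc.combo_closure_interior_mem_interior hm.1 (by rw [hGo.interior_eq]; exact hgG)
        (a := 1 - s) (b := s) (by linarith) hs0 (by ring)
      rw [hGo.interior_eq] at h
      have e : (1 - s) • m + s • g = γ s := by
        simp only [hγ]; ext <;> simp [smul_eq_mul]
      rw [e] at h; exact h
    have hγT : γ s ∈ T := by
      have h := convex_densityTriangle_closed hm.2 hgT (a := 1 - s) (b := s) (by linarith) hs0.le (by ring)
      have e : (1 - s) • m + s • g = γ s := by
        simp only [hγ]; ext <;> simp [smul_eq_mul]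
      rw [e] at h; exact h
    filter_upwards [ldp_lower_open_closed hy hz hGo hγG hγT hε2] with N hN
    refine le_trans (Real.exp_le_exp.2 (mul_le_mul_of_nonneg_right ?_ (Nat.cast_nonneg N))) hN
    change -(J m) - ε ≤ -(J (γ s)) - ε / 2
    linarith
  · -- upper bound: `G ⊆ cl G`
    filter_upwards [hup hε] with N hN
    refine le_trans ?_ hN
    refine div_le_div_of_nonneg_right ?_ (stripZ₂_pos 1 N hy hz).le
    refine Finset.sum_le_sum_of_subset_of_nonneg (fun q hq => ?_) fun q _ _ => wgt_nonneg hy.le hz.le N q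
    rw [Finset.mem_filter] at hq ⊢
    exact ⟨hq.1, subset_closure hq.2⟩

end Literature.Probability.RandomPlanarGeometry.SAW.HexBW
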